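/-
Copyright (c) 2026 the pub-hodgecm-mathlib formalisation cell (harness21).  Prover seat hodgecm-mathlib-K2E1-p13 (g5), Track B ∕ K2-LIT, h413 = `stmt-HodgeConjecture-24833`,
R90-TF section S8 «ContSpec-n½», S8 dealer R90-CS-plan (g3) S8-R214 «EXPONENT TABLE» (offer (i) after the (∞-2) files ★ p864090 ∕ p864245 ∕ p864291 ∕ p864325): the table
`m_w ↦ (p_w, q_w)` that discharges `hm` of ★ `arch_integral_ne_zero_shifted` from the parity of record, and the CONSUMER HEAD naming ★ `archSectionShifted … p q` as THE archimedean
witness of a general block.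
-/
import Summits.HodgeConjecture.HodgeConjecture.Theorems.K2E1ChiArchShiftedNonvanishingU3   -- ★ p864325 (this seat): HEAD `arch_integral_ne_zero_shifted` (γ2) over ★ (γ1) + ★ (a-10) engine
import Summits.HodgeConjecture.HodgeConjecture.Theorems.K2E1ArchSectionLOnBigCellU3        -- ★ p863894∕p863919 (this seat): `exists_hasUnitaryArchType_of_hquad` (the `m_w` table, `kμ` odd)
import HarnessLib

/-!
# K2·E1 ∕ R90·S8 — `K2E1ChiArchShiftedExponentTableU3`: THE SHIFT EXPONENTS OF RECORD `p_w = ((m_w − 1)∕2)⁺`, `q_w = ((−m_w − 1)∕2)⁺` (`m_w = kμ,w − 2eη,w` odd) and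
# the ARCHIMEDEAN HALF OF `hA32` FOR A GENERAL BLOCK with NO range letter: `∫∫ (∏_w ε_w·archUnitaryValue m_w 0 ζ_w·((2+ζ_w)∕ζ_w)^{p_w}·((2+conj ζ_w)∕conj ζ_w)^{q_w})·ARCH₃^{−3∕2} ≠ 0`

Cell `pub/hodgecm-mathlib`, crux h413 = `stmt-HodgeConjecture-24833`, route of record `HCCMUnconditional`; R90-TF section S8 «ContSpec-n½», road R2-χ₃, (V)(iii) row `hA32` for GENERAL
blocks (S8-R192 (∞-2) ∕ S8-R214).  THEOREMS ONLY (no `def`, no `instance`, no notation, no named-fact hypothesis, no `sorry`; default heartbeats); lane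
`--supports stmt-HodgeConjecture-24833 --as helper` (count-neutral).  CLOSES NO SOCKET: it removes the binders `p q` + table clause (`hm`) from the consumers of ★ p864325 — for the
block of record `(ξ, μω)` (`μω` of unitary type `(kμ, 0)`, `kμ,w ≡ 1 [ZMOD 2]` by ★ `exists_hasUnitaryArchType_of_hquad`) THE archimedean witness is
★ `archSectionShifted (ξ.bcη⁻¹·ξ.bcψ⁻¹·μω) ξ.ψ p q` with the EXPLICIT exponents below, and its big-cell weight (★ `archSectionShifted_midBlock_bigCell` × ★ `archShiftFactor_bigCell_zeta`,
phase `archUnitaryValue m_w 0 ζ_w`) has a non-zero archimedean factor at `3∕2` — §3, letters of ★ (a-10c) HEAD-1 verbatim with `m_w := kμ,w − 2·ξ.eη w`.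
* §1 integer arithmetic: `odd_of_modEq_one_sub_two_mul`, `shiftExponents_spec_of_pos ∕ _of_neg`, **`shiftExponents_spec`**, `exists_shiftExponents`, `exists_shiftExponents_of_modEq`.
* §2 block of record: **`exists_blockExponents_of_hquad`** (`∃ kμ p q`, type `(kμ,0)` ∧ table).
* §3 **`arch_integral_ne_zero_midBlock_shifted`** — ★ `arch_integral_ne_zero_shifted` with `m_w = kμ,w − 2eη,w`, `p_w = ((m_w−1)∕2).toNat`, `q_w = ((−m_w−1)∕2).toNat`, NO `hm`∕`hm1` letter.
HONEST LABEL: HC_CM is proved only modulo the 7 printed citations (2 remaining named inputs: hLiu418 = `stmt-HodgeConjecture-24832`, h413 = `stmt-HodgeConjecture-24833`) until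
rung 0 closes; REL ≠ ★ ≠ BUILT; this file asserts no named fact and closes no socket (the shifted witness pays (V) on general blocks only through ESTATE T's K-finite exports at the
finite level of record); count-neutral.

## References
* [Patrikis2019] S. Patrikis, *Variations on a theorem of Tate*, Mem. AMS 258 (2019): §2.1 (parity of unitary archimedean types).
* [MoeglinWaldspurger1995] C. Mœglin, J.-L. Waldspurger, *Spectral Decomposition and Eisenstein Series* (1995): IV.1.11.
* [Liu2021] Y. Liu, *Theta correspondence for almost unramified representations of unitary groups*, J. Number Theory (2021): Remark 4.2.
-/

set_option autoImplicit false
set_option linter.dupNamespace false -- the mandated namespace repeats `HodgeConjecture.HodgeConjecture`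

noncomputable section

open MeasureTheory MeasureTheory.Measure NumberField NumberField.InfinitePlace
open scoped ComplexConjugate
open Literature.NumberTheory.GaloisRepresentations (archUnitaryValue HeckeCharacter)
open Literature.NumberTheory.Automorphic
open Literature.NumberTheory.Rogawski1990 (OneDimAutRepH)
open Summit.HodgeConjecture.HodgeConjecture.Cruxes.H413
open Summit.HodgeConjecture.HodgeConjecture.Cruxes.H413.K2E1ArchSectionLOnBigCellU3 (exists_hasUnitaryArchType_of_hquad)
open Summit.HodgeConjecture.HodgeConjecture.Cruxes.H413.K2E1ChiArchShiftedNonvanishingU3 (arch_integral_ne_zero_shifted)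

namespace Summit.HodgeConjecture.HodgeConjecture.Cruxes.H413.K2E1ChiArchShiftedExponentTableU3

/-! ## §1 Integer arithmetic: odd `m ↦ (p, q)` -/

/-- **`kμ − 2e` is odd when `kμ ≡ 1 [ZMOD 2]`** (the coupling exponent `m_w = kμ,w − 2eη,w` of the `m_w` table). [cite: Patrikis2019, §2.1] -/
theorem odd_of_modEq_one_sub_two_mul {k : ℤ} (hk : k ≡ 1 [ZMOD 2]) (e : ℤ) : Odd (k - 2 * e) := by
  obtain ⟨c, hc⟩ := (Int.modEq_iff_dvd.1 hk.symm)
  exact ⟨c - e, by linarith⟩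

/-- Positive odd `m = 2k + 1 ≥ 1`: `((m − 1)∕2).toNat = k`, `((−m − 1)∕2).toNat = 0`, and `m = 2·k + 1`. [folklore] -/
theorem shiftExponents_spec_of_pos {m : ℤ} (hm : Odd m) (h0 : 0 ≤ m) :
    m = 2 * ((((m - 1) / 2).toNat : ℕ) : ℤ) + 1 ∧ ((-m - 1) / 2).toNat = 0 := by
  obtain ⟨k, rfl⟩ := hm
  have hk : 0 ≤ k := by omega
  refine ⟨?_, ?_⟩
  · rw [show (2 * k + 1 - 1) / 2 = k by omega, Int.toNat_of_nonneg hk]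
  · rw [Int.toNat_eq_zero]
    omega

/-- Negative odd `m = 2k + 1 ≤ −1`: `((−m − 1)∕2).toNat = −k − 1`, `((m − 1)∕2).toNat = 0`, and `m = −(2·(−k−1) + 1)`. [folklore] -/
theorem shiftExponents_spec_of_neg {m : ℤ} (hm : Odd m) (h0 : m < 0) :
    m = -(2 * ((((-m - 1) / 2).toNat : ℕ) : ℤ) + 1) ∧ ((m - 1) / 2).toNat = 0 := by
  obtain ⟨k, rfl⟩ := hm
  have hk : 0 ≤ -k - 1 := by omega
  refine ⟨?_, ?_⟩
  · rw [show (-(2 * k + 1) - 1) / 2 = -k - 1 by omega, Int.toNat_of_nonneg hk]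
    ring
  · rw [Int.toNat_eq_zero]
    omega

/-- **THE EXPONENT TABLE.**  For odd integers `m_w` the explicit shifts `p_w := ((m_w − 1)∕2).toNat`, `q_w := ((−m_w − 1)∕2).toNat` satisfy at every place
`m_w = 2p_w + 1 ∧ q_w = 0` or `m_w = −(2q_w + 1) ∧ p_w = 0` — the hypothesis `hm` of ★ `arch_integral_ne_zero_shifted`. [cite: Patrikis2019, §2.1] -/
theorem shiftExponents_spec {ι : Type*} (m : ι → ℤ) (hm : ∀ w, Odd (m w)) (w : ι) :
    (m w = 2 * (((fun v => ((m v - 1) / 2).toNat) w : ℕ) : ℤ) + 1 ∧ (fun v => ((-m v - 1) / 2).toNat) w = 0) ∨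
      (m w = -(2 * (((fun v => ((-m v - 1) / 2).toNat) w : ℕ) : ℤ) + 1) ∧ (fun v => ((m v - 1) / 2).toNat) w = 0) := by
  rcases le_or_gt 0 (m w) with h | h
  · exact Or.inl (shiftExponents_spec_of_pos (hm w) h)
  · exact Or.inr (shiftExponents_spec_of_neg (hm w) h)

/-- **Existence form**: odd `m_w` admit shift exponents `p, q` with the dichotomy of ★ `arch_integral_ne_zero_shifted`. [cite: Patrikis2019, §2.1] -/
theorem exists_shiftExponents {ι : Type*} (m : ι → ℤ) (hm : ∀ w, Odd (m w)) :
    ∃ p q : ι → ℕ, ∀ w, (m w = 2 * (p w : ℤ) + 1 ∧ q w = 0) ∨ (m w = -(2 * (q w : ℤ) + 1) ∧ p w = 0) :=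
  ⟨fun v => ((m v - 1) / 2).toNat, fun v => ((-m v - 1) / 2).toNat, shiftExponents_spec m hm⟩

/-- The table for the coupling exponents of record `m_w = kμ,w − 2eη,w` (`kμ,w ≡ 1 [ZMOD 2]`). [cite: Patrikis2019, §2.1] -/
theorem exists_shiftExponents_of_modEq {ι : Type*} (kμ eη : ι → ℤ) (hk : ∀ w, kμ w ≡ 1 [ZMOD 2]) :
    ∃ p q : ι → ℕ, ∀ w, (kμ w - 2 * eη w = 2 * (p w : ℤ) + 1 ∧ q w = 0) ∨ (kμ w - 2 * eη w = -(2 * (q w : ℤ) + 1) ∧ p w = 0) :=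
  exists_shiftExponents (fun w => kμ w - 2 * eη w) fun w => odd_of_modEq_one_sub_two_mul (hk w) (eη w)


/-! ## §2 The block of record: `μω` of type `(kμ, 0)` with `kμ` odd ⇒ exponents for `m_w = kμ,w − 2eη,w` -/

section Block

variable (L : Type) [Field L] [NumberField L] [IsCMField L]

/-- **THE EXPONENTS OF THE BLOCK OF RECORD.**  From the frame's `hquad` (★ `exists_hasUnitaryArchType_of_hquad`): `μω` has unitary type `(kμ, 0)` with `kμ,w` odd, and the
coupling exponents `m_w = kμ,w − 2·ξ.eη w` admit shifts `p, q` with the dichotomy of ★ `arch_integral_ne_zero_shifted`. [cite: Liu2021, Remark 4.2] [cite: Patrikis2019, §2.1] -/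
theorem exists_blockExponents_of_hquad (ξ : OneDimAutRepH L) {μω : HeckeCharacter L} (hμu : μω.IsUnitary)
    (hquad : ∀ x : Literature.NumberTheory.GaloisRepresentations.ideleGroup ↥(maximalRealSubfield L), μω (AdeleRing.ideleBaseChange (↥(maximalRealSubfield L)) L x) = quadraticHeckeCharCM L x) :
    ∃ (kμ : InfinitePlace L → ℤ) (p q : InfinitePlace L → ℕ), μω.HasUnitaryArchType kμ 0 ∧
      ∀ w, (kμ w - 2 * ξ.eη w = 2 * (p w : ℤ) + 1 ∧ q w = 0) ∨ (kμ w - 2 * ξ.eη w = -(2 * (q w : ℤ) + 1) ∧ p w = 0) := by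
  obtain ⟨kμ, hμ, hk⟩ := exists_hasUnitaryArchType_of_hquad L hμu hquad
  obtain ⟨p, q, hpq⟩ := exists_shiftExponents_of_modEq kμ ξ.eη hk
  exact ⟨kμ, p, q, hμ, hpq⟩

end Block

/-! ## §3 THE CONSUMER HEAD: the archimedean half of `hA32` for a general block, no range letter -/

section Head

variable (L : Type) [Field L] [NumberField L] [IsCMField L] {δ : L} (hδ : δ ≠ 0)
  [MeasurableSpace (InfiniteAdeleRing L)] [BorelSpace (InfiniteAdeleRing L)]
  [MeasurableSpace (InfiniteAdeleRing ↥(maximalRealSubfield L))] [BorelSpace (InfiniteAdeleRing ↥(maximalRealSubfield L))]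
  (μE₁ : Measure (InfiniteAdeleRing L)) [μE₁.IsAddHaarMeasure] (μF₁ : Measure (InfiniteAdeleRing ↥(maximalRealSubfield L))) [μF₁.IsAddHaarMeasure]

include hδ in
/-- **THE ARCHIMEDEAN WITNESS OF A GENERAL BLOCK.**  For the block of record (`kμ,w ≡ 1 [ZMOD 2]`, coupling exponents `m_w := kμ,w − 2·ξ.eη w`), the SHIFTED section
★ `archSectionShifted (ξ.bcη⁻¹·ξ.bcψ⁻¹·μω) ξ.ψ p q` with the explicit exponents `p_w := ((m_w − 1)∕2).toNat`, `q_w := ((−m_w − 1)∕2).toNat` has a NON-ZERO archimedean factor at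
`z = 3∕2`: in ★ (a-3)'s iterated bytes (letters of ★ (a-10c) HEAD-1, `0 < ‖ε_w‖ ≤ 1`, `β_w² = (wδ)²`),
`∫_{L_∞}∫_{L⁺_∞} (∏_w ε_w·archUnitaryValue m_w 0 ζ_w·((2+ζ_w)∕ζ_w)^{p_w}·((2+conj ζ_w)∕conj ζ_w)^{q_w})·ARCH₃^{−3∕2} ≠ 0` — NO range letter `|m_w| ≤ 2` ∕ `hm1`.  (★ p864325 + §1 table.)
[cite: MoeglinWaldspurger1995, IV.1.11] [cite: Patrikis2019, §2.1] -/
theorem arch_integral_ne_zero_midBlock_shifted (ξ : OneDimAutRepH L) (kμ : InfinitePlace L → ℤ) (hk : ∀ w, kμ w ≡ 1 [ZMOD 2])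
    (ε : InfinitePlace L → ℂ) (hε1 : ∀ w, ‖ε w‖ ≤ 1) (hε0 : ∀ w, ε w ≠ 0) (β : InfinitePlace L → ℝ) (hβ : ∀ w, β w ^ 2 = (w δ) ^ 2) :
    (∫ Xi : InfiniteAdeleRing L, ∫ a : InfiniteAdeleRing ↥(maximalRealSubfield L),
      (∏ w : InfinitePlace L, ε w * archUnitaryValue (kμ w - 2 * ξ.eη w) 0 ((((-(1 + ‖Xi w‖ ^ 2 / 2)) : ℝ) : ℂ) + ((β w * ((InfiniteAdeleRing.ringEquiv_mixedSpace ↥(maximalRealSubfield L)) a).1 ⟨w.comap (algebraMap ↥(maximalRealSubfield L) L), K2E1HeightBigCellLineFormulaU2.isReal_comap_maximalRealSubfield L w⟩ : ℝ) : ℂ) * Complex.I) * (((2 : ℂ) + ((((-(1 + ‖Xi w‖ ^ 2 / 2)) : ℝ) : ℂ) + ((β w * ((InfiniteAdeleRing.ringEquiv_mixedSpace ↥(maximalRealSubfield L)) a).1 ⟨w.comap (algebraMap ↥(maximalRealSubfield L) L), K2E1HeightBigCellLineFormulaU2.isReal_comap_maximalRealSubfield L w⟩ : ℝ) : ℂ)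 * Complex.I)) / ((((-(1 + ‖Xi w‖ ^ 2 / 2)) : ℝ) : ℂ) + ((β w * ((InfiniteAdeleRing.ringEquiv_mixedSpace ↥(maximalRealSubfield L)) a).1 ⟨w.comap (algebraMap ↥(maximalRealSubfield L) L), K2E1HeightBigCellLineFormulaU2.isReal_comap_maximalRealSubfield L w⟩ : ℝ) : ℂ) * Complex.I)) ^ ((kμ w - 2 * ξ.eη w - 1) / 2).toNat * (((2 : ℂ) + conj ((((-(1 + ‖Xi w‖ ^ 2 / 2)) : ℝ) : ℂ) + ((β w * ((InfiniteAdeleRing.ringEquiv_mixedSpace ↥(maximalRealSubfield L)) a).1 ⟨w.comap (algebraMap ↥(maximalRealSubfield L) L), K2E1HeightBigCellLineFormulaU2.isReal_comap_maximalRealSubfield L w⟩ : ℝ) : ℂ) * Complex.I)) / conj ((((-(1 + ‖Xi w‖ ^ 2 / 2)) : ℝ) : ℂ) + ((β w * ((InfiniteAdeleRing.ringEquiv_mixedSpace ↥(maximalRealSubfield L)) a).1 ⟨w.comap (algebraMap ↥(maximalRealSubfield L) L), K2E1HeightBigCellLineFormulaU2.isReal_comap_maximalRealSubfield L w⟩ :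 ℝ) : ℂ) * Complex.I)) ^ ((-(kμ w - 2 * ξ.eη w) - 1) / 2).toNat) *
        ((((∏ w : InfinitePlace L, ((1 + ‖(Xi) w‖ ^ 2 / 2) ^ 2 + (w δ) ^ 2 * (((InfiniteAdeleRing.ringEquiv_mixedSpace ↥(maximalRealSubfield L)) a).1 ⟨w.comap (algebraMap ↥(maximalRealSubfield L) L), K2E1HeightBigCellLineFormulaU2.isReal_comap_maximalRealSubfield L w⟩) ^ 2))) : ℝ) : ℂ) ^ (-(3 / 2 : ℂ)) ∂μF₁ ∂μE₁) ≠ 0 :=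
  arch_integral_ne_zero_shifted L hδ μE₁ μF₁ ε hε1 hε0 β hβ (fun w => kμ w - 2 * ξ.eη w) _ _
    (shiftExponents_spec (fun w => kμ w - 2 * ξ.eη w) fun w => odd_of_modEq_one_sub_two_mul (hk w) (ξ.eη w))

end Head

end Summit.HodgeConjecture.HodgeConjecture.Cruxes.H413.K2E1ChiArchShiftedExponentTableU3

end
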